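import Summits.BirchSwinnertonDyer.BirchSwinnertonDyer.Theorems.PrintCf2SplitBadTwoRestrictedSelmerBottomKummerSquare
import Summits.BirchSwinnertonDyer.BirchSwinnertonDyer.Theorems.PrintCf2SplitBadTwoCMPrimaryModule
import Literature.NumberTheory.EllipticCurves.PeriodIndexCorestrictionLocal
import HarnessLib

/-!
# Crux `PrintCf2.SplitBadTwoRankOneOfFacts` (stmt-BirchSwinnertonDyer-20368), road α, stub S3c — typing target T1-a of
# `S3C-LEVELK-POITOU-TATE-TYPING-g12.md`: the EQUIVARIANT EIGEN-PROJECTOR `E[p^∞] → E[𝔮^∞]` and the induced SPLITTING of `H¹`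

Cell `bsd-print-cf2`, width seat `bsd-line-cf2-p1-w7` g2, file 3 of the bottom-value lane (p661732 `…BottomSnake`, p662108
`…BottomKummerSquare`); `--supports stmt-BirchSwinnertonDyer-20368` (helper, Theses-free). HONEST FRAMING: nothing here closes a crux
or a stub; BSD is not proved by any of this; no summit statement is proved by this seat. No definition, no named fact, no `sorry`,
no kit. beyond-print theorem: no (linear algebra / functoriality of `H¹`).

WHY. The Kummer square of p662108 wants the «global Kummer map OF THE SUMMAND» `k : E(K) ⊗ ℚ_p/ℤ_p → H¹(K, W*)`, `W* = E[𝔮^∞] =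
V.endEigenPrimaryTorsion p π r ≤ E[p^∞]` (p646843). The tree's Kummer map (`WeierstrassCurve.kummerMapPInfty`, SelmerCorankProofs) has
values in `H¹(K, E[p^∞])`; to PROJECT it to the summand one needs a `Γ_K`-equivariant projector `e : E[p^∞] → E[𝔮^∞]` along the
complementary eigen-subgroup `E[𝔮̄^∞] = V.endEigenPrimaryTorsion p π r′` (for the class: `r′ = 1 − r`, `⊓ = ⊥`, `⊔ = ⊤` by -w2 g7's
`CMPrimes.endEigenPrimaryTorsion_two_structure`), and the resulting splitting of cohomology
`H¹(L, E[p^∞]) = ι_* H¹(L, E[𝔮^∞]) ⊕ ι′_* H¹(L, E[𝔮̄^∞])` (LEAD g12 memo §3 T1: «the v̄-eigen projection of the tree's `E[2^k]`-Kummer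
sequence»). This file supplies exactly that, generically.

WHAT IS PROVED.
* §1 (pure algebra, any abelian group `M`, subgroups `C₁ ⊓ C₂ = ⊥`, `C₁ ⊔ C₂ = ⊤`): `exists_proj_of_inf_eq_bot_of_sup_eq_top` — a projector
  `e : M →+ M` onto `C₁` along `C₂` (identity on `C₁`, zero on `C₂`, `e x ∈ C₁`, `x − e x ∈ C₂`); `proj_apply_eq_of_mem_add` (uniqueness of
  values); `proj_map_comm` — `e` commutes with every endomorphism preserving `C₁` and `C₂`; `proj_smul_comm` — hence with every element of a
  group acting by such automorphisms.
* §2 (curve `V/K`, prime `p`, `π ∈ End_K(E)`, `p`-adic `r`, `r′` with `E[𝔮^∞] ⊓ E[𝔮̄^∞] = ⊥`, `⊔ = ⊤`): `exists_eigenProjector` — a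
  `Γ_K`-equivariant `e : E[p^∞] →+ E[𝔮^∞]` with `e ∘ ι = id`, `e = 0` on `E[𝔮̄^∞]`, `x − ι(e x) ∈ E[𝔮̄^∞]`; `resH1Hom_proj_comp_subtype`
  (`e_* ∘ ι_* = id` on `H¹(H, E[𝔮^∞])` for every `H ≤ Γ_K`), `resH1Hom_subtype_injective` (`ι_*` injective: `H¹(H, E[𝔮^∞])` IS a direct
  summand of `H¹(H, E[p^∞])`), `resH1Hom_proj_surjective`, `resH1Hom_add_coeff` (additivity of `ψ ↦ ψ_*`) and the SPLITTING
  `resH1Hom_subtype_proj_add_eq` (`ι_* e_* x + ι′_* e′_* x = x`); `resH1Hom_proj_mem_restrictedSelmer` (`e_*` maps `𝔖_𝔮(L, E[p^∞])` into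
  `𝔖_𝔮(L, E[𝔮^∞])`, by -w7 g0 p649193).
* §3 road α BY NAME (`W/ℚ`, `W.j = −3375`, `L ∋ θ`, `θ² = −7`, `π² = π − 2`, `r² = r − 2`): `exists_eigenProjector_two` with `r′ = 1 − r`.

presearch: linear algebra (projector of a direct-sum decomposition) and Serre I.§2.4 functoriality; nothing to cite beyond the tree.
References: J.-P. Serre, *Galois Cohomology* (1997) I.§2.4 [SerreGaloisCohomology1997]; K. Rubin, LNM 1716 (1999) §2
[Rubin1999]; A. Agboola, Compositio 143 (2007) §3, §6 [Agboola2007].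
-/

noncomputable section

open scoped Classical

set_option linter.dupNamespace false
set_option autoImplicit false

open NumberField IsDedekindDomain Field
open Literature.NumberTheory.EllipticCurves Literature.NumberTheory.EllipticCurves.GreenbergSelmer
open Literature.NumberTheory.EllipticCurves.Castella2018.AcSelmer
open Literature.NumberTheory.EllipticCurves.Agboola2007
open Literature.NumberTheory.GaloisRepresentations

universe u

namespace Summit.BirchSwinnertonDyer.BirchSwinnertonDyer.Theorems.PrintCf2.RestrictedSelmerPair

/-! ## §1. The projector of a complementary pair of subgroups -/

section Projector

variable {M : Type*} [AddCommGroup M] (C₁ C₂ : AddSubgroup M)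

/-- **Projector onto `C₁` along `C₂`** for subgroups with `C₁ ⊓ C₂ = ⊥`, `C₁ ⊔ C₂ = ⊤`: an additive `e : M → M` which is the identity on
`C₁`, zero on `C₂`, takes values in `C₁`, and with `x − e x ∈ C₂`. [folklore] -/
theorem exists_proj_of_inf_eq_bot_of_sup_eq_top (hinf : C₁ ⊓ C₂ = ⊥) (hsup : C₁ ⊔ C₂ = ⊤) :
    ∃ e : M →+ M, (∀ x ∈ C₁, e x = x) ∧ (∀ x ∈ C₂, e x = 0) ∧ (∀ x, e x ∈ C₁) ∧ ∀ x, x - e x ∈ C₂ := by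
  have hdec : ∀ x : M, ∃ y : M, y ∈ C₁ ∧ ∃ z ∈ C₂, y + z = x := by
    intro x
    have hx : x ∈ C₁ ⊔ C₂ := by rw [hsup]; exact AddSubgroup.mem_top x
    obtain ⟨y, hy, z, hz, h⟩ := AddSubgroup.mem_sup.1 hx
    exact ⟨y, hy, z, hz, h⟩
  choose f hf₁ g hg₂ hfg using hdec
  have huniq : ∀ (x y z : M), y ∈ C₁ → z ∈ C₂ → y + z = x → f x = y := by
    intro x y z hy hz h
    exact (CMPrimes.eq_of_add_eq_add_of_inf_eq_bot hinf (hf₁ x) (hg₂ x) hy hz (by rw [hfg x, h])).1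
  refine ⟨AddMonoidHom.mk' f ?_, ?_, ?_, ?_, ?_⟩
  · intro a b
    exact huniq (a + b) (f a + f b) (g a + g b) (C₁.add_mem (hf₁ a) (hf₁ b)) (C₂.add_mem (hg₂ a) (hg₂ b))
      (by rw [add_add_add_comm, hfg a, hfg b])
  · intro x hx
    exact huniq x x 0 hx C₂.zero_mem (add_zero x)
  · intro x hx
    exact huniq x 0 x C₁.zero_mem hx (zero_add x)
  · exact fun x ↦ hf₁ x
  · intro x
    have h : x - f x = g x := by rw [sub_eq_iff_eq_add', hfg x]
    change x - f x ∈ C₂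
    rw [h]
    exact hg₂ x

variable {C₁ C₂}

/-- **Values of a projector are forced**: if `e` is the identity on `C₁` and zero on `C₂`, then `e (y + z) = y` for `y ∈ C₁`,
`z ∈ C₂`. [folklore] -/
theorem proj_apply_eq_of_mem_add {e : M →+ M} (he₁ : ∀ x ∈ C₁, e x = x) (he₂ : ∀ x ∈ C₂, e x = 0) {y z : M}
    (hy : y ∈ C₁) (hz : z ∈ C₂) : e (y + z) = y := by
  rw [map_add, he₁ y hy, he₂ z hz, add_zero]

/-- **A projector commutes with every endomorphism preserving both summands** (`C₁ ⊔ C₂ = ⊤`): `e (g x) = g (e x)`.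
[folklore] -/
theorem proj_map_comm (hsup : C₁ ⊔ C₂ = ⊤) {e : M →+ M} (he₁ : ∀ x ∈ C₁, e x = x) (he₂ : ∀ x ∈ C₂, e x = 0)
    (g : M →+ M) (hg₁ : ∀ x ∈ C₁, g x ∈ C₁) (hg₂ : ∀ x ∈ C₂, g x ∈ C₂) (x : M) : e (g x) = g (e x) := by
  have hx : x ∈ C₁ ⊔ C₂ := by rw [hsup]; exact AddSubgroup.mem_top x
  obtain ⟨y, hy, z, hz, rfl⟩ := AddSubgroup.mem_sup.1 hx
  rw [map_add g, proj_apply_eq_of_mem_add he₁ he₂ (hg₁ y hy) (hg₂ z hz), proj_apply_eq_of_mem_add he₁ he₂ hy hz]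

/-- **A projector commutes with a group acting through summand-preserving automorphisms**: `e (σ • x) = σ • e x`.
[folklore] -/
theorem proj_smul_comm {G : Type*} [Monoid G] [DistribMulAction G M] (hsup : C₁ ⊔ C₂ = ⊤) {e : M →+ M}
    (he₁ : ∀ x ∈ C₁, e x = x) (he₂ : ∀ x ∈ C₂, e x = 0) (σ : G) (hσ₁ : ∀ x ∈ C₁, σ • x ∈ C₁)
    (hσ₂ : ∀ x ∈ C₂, σ • x ∈ C₂) (x : M) : e (σ • x) = σ • e x :=
  proj_map_comm hsup he₁ he₂ (DistribSMul.toAddMonoidHom M σ) hσ₁ hσ₂ x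

end Projector

/-! ## §2. The eigen-projector `E[p^∞] → E[𝔮^∞]` and the splitting of `H¹` -/

section Eigen

variable {K : Type u} [Field K] (V : WeierstrassCurve K) (p : ℕ) [Fact p.Prime] (π : V.endRing) (r r' : ℤ_[p])

/-- **The `Γ_K`-equivariant eigen-projector.** If the two eigen-subgroups `E[𝔮^∞] = V.endEigenPrimaryTorsion p π r` and
`E[𝔮̄^∞] = V.endEigenPrimaryTorsion p π r′` are complementary (`⊓ = ⊥`, `⊔ = ⊤`), there is an additive `e : E[p^∞] → E[𝔮^∞]` with
`e ∘ ι = id`, `e = 0` on `E[𝔮̄^∞]`, `x − ι (e x) ∈ E[𝔮̄^∞]`, commuting with `Γ_K` (both summands are `Γ_K`-stable, p646843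
`smul_mem_endEigenPrimaryTorsion`). [cite: Rubin1999, §2 and Prop. 5.4] -/
theorem exists_eigenProjector (hinf : V.endEigenPrimaryTorsion p π r ⊓ V.endEigenPrimaryTorsion p π r' = ⊥)
    (hsup : V.endEigenPrimaryTorsion p π r ⊔ V.endEigenPrimaryTorsion p π r' = ⊤) :
    ∃ e : V.geomPrimaryTorsion p →+ ↥(V.endEigenPrimaryTorsion p π r),
      (∀ x : ↥(V.endEigenPrimaryTorsion p π r), e x = x) ∧
      (∀ x ∈ V.endEigenPrimaryTorsion p π r', e x = 0) ∧
      (∀ x, x - (e x : V.geomPrimaryTorsion p) ∈ V.endEigenPrimaryTorsion p π r') ∧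
      ∀ (σ : absoluteGaloisGroup K) (x : V.geomPrimaryTorsion p), e (σ • x) = σ • e x := by
  obtain ⟨e, he₁, he₂, hemem, hesub⟩ :=
    exists_proj_of_inf_eq_bot_of_sup_eq_top (V.endEigenPrimaryTorsion p π r) (V.endEigenPrimaryTorsion p π r') hinf hsup
  refine ⟨e.codRestrict (V.endEigenPrimaryTorsion p π r) hemem, fun x ↦ Subtype.ext (he₁ x x.2), fun x hx ↦ Subtype.ext (he₂ x hx),
    fun x ↦ hesub x, fun σ x ↦ Subtype.ext ?_⟩
  change e (σ • x) = σ • e x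
  exact proj_smul_comm hsup he₁ he₂ σ (fun y hy ↦ V.smul_mem_endEigenPrimaryTorsion π r σ hy)
    (fun y hy ↦ V.smul_mem_endEigenPrimaryTorsion π r' σ hy) x

variable (H : Subgroup (absoluteGaloisGroup K))

/-- **`e_* ∘ ι_* = id` on `H¹(H, E[𝔮^∞])`** for every `H ≤ Γ_K` and every equivariant `e : E[p^∞] → E[𝔮^∞]` with `e ∘ ι = id`
(functoriality of `H¹` in compatible pairs, Serre I.§2.4). [cite: SerreGaloisCohomology1997, I.§2.4] -/
theorem resH1Hom_proj_comp_subtype (e : V.geomPrimaryTorsion p →+ ↥(V.endEigenPrimaryTorsion p π r))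
    (he₁ : ∀ x : ↥(V.endEigenPrimaryTorsion p π r), e x = x)
    (he : ∀ (σ : absoluteGaloisGroup K) (x : V.geomPrimaryTorsion p), e (σ • x) = σ • e x) :
    (resH1Hom (ContinuousMonoidHom.id H) e (fun σ x ↦ he σ x)).comp
        (resH1Hom (ContinuousMonoidHom.id H) (V.endEigenPrimaryTorsion p π r).subtype (fun _ _ ↦ rfl)) =
      AddMonoidHom.id _ := by
  rw [resH1Hom_comp]
  have hcomp : e.comp (V.endEigenPrimaryTorsion p π r).subtype = AddMonoidHom.id _ := AddMonoidHom.ext fun x ↦ he₁ x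
  have hφ : (ContinuousMonoidHom.id H).comp (ContinuousMonoidHom.id H) = ContinuousMonoidHom.id H :=
    ContinuousMonoidHom.ext fun _ ↦ rfl
  rw [resH1Hom_congr hφ hcomp _ (fun _ _ ↦ rfl), resH1Hom_id]

/-- **`ι_* : H¹(H, E[𝔮^∞]) → H¹(H, E[p^∞])` is injective** — `H¹` of the eigen-summand is a DIRECT SUMMAND of `H¹(H, E[p^∞])`.
[cite: SerreGaloisCohomology1997, I.§2.4] -/
theorem resH1Hom_subtype_injective (e : V.geomPrimaryTorsion p →+ ↥(V.endEigenPrimaryTorsion p π r))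
    (he₁ : ∀ x : ↥(V.endEigenPrimaryTorsion p π r), e x = x)
    (he : ∀ (σ : absoluteGaloisGroup K) (x : V.geomPrimaryTorsion p), e (σ • x) = σ • e x) :
    Function.Injective (resH1Hom (ContinuousMonoidHom.id H) (V.endEigenPrimaryTorsion p π r).subtype (fun _ _ ↦ rfl)) := by
  intro a b hab
  have h := congrArg (resH1Hom (ContinuousMonoidHom.id H) e (fun σ x ↦ he σ x)) hab
  have hid := resH1Hom_proj_comp_subtype V p π r H e he₁ he
  have ha := congrArg (fun f ↦ f a) hid
  have hb := congrArg (fun f ↦ f b) hid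
  simp only [AddMonoidHom.comp_apply, AddMonoidHom.id_apply] at ha hb
  rwa [ha, hb] at h

/-- **`e_* : H¹(H, E[p^∞]) → H¹(H, E[𝔮^∞])` is surjective.** [cite: SerreGaloisCohomology1997, I.§2.4] -/
theorem resH1Hom_proj_surjective (e : V.geomPrimaryTorsion p →+ ↥(V.endEigenPrimaryTorsion p π r))
    (he₁ : ∀ x : ↥(V.endEigenPrimaryTorsion p π r), e x = x)
    (he : ∀ (σ : absoluteGaloisGroup K) (x : V.geomPrimaryTorsion p), e (σ • x) = σ • e x) :
    Function.Surjective (resH1Hom (ContinuousMonoidHom.id H) e (fun σ x ↦ he σ x)) := by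
  intro c
  refine ⟨resH1Hom (ContinuousMonoidHom.id H) (V.endEigenPrimaryTorsion p π r).subtype (fun _ _ ↦ rfl) c, ?_⟩
  have h := congrArg (fun f ↦ f c) (resH1Hom_proj_comp_subtype V p π r H e he₁ he)
  simpa only [AddMonoidHom.comp_apply, AddMonoidHom.id_apply] using h

/-- **`e_*` maps Agboola's `𝔖_𝔮(L, E[p^∞])` into `𝔖_𝔮(L, E[𝔮^∞])`** (coefficient functoriality of the restricted Selmer group,
-w7 g0 `resH1Hom_id_mem_restrictedSelmer`). [cite: Agboola2007, §3 (arXiv p0008:L58–68)] -/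
theorem resH1Hom_proj_mem_restrictedSelmer [NumberField K] [H.Normal] (𝔮 : HeightOneSpectrum (𝓞 K))
    (e : V.geomPrimaryTorsion p →+ ↥(V.endEigenPrimaryTorsion p π r))
    (he : ∀ (σ : absoluteGaloisGroup K) (x : V.geomPrimaryTorsion p), e (σ • x) = σ • e x)
    {c : subgroupH1 H (V.geomPrimaryTorsion p)} (hc : c ∈ restrictedSelmer H (V.geomPrimaryTorsion p) p 𝔮) :
    resH1Hom (ContinuousMonoidHom.id H) e (fun σ x ↦ he σ x) c ∈ restrictedSelmer H ↥(V.endEigenPrimaryTorsion p π r) p 𝔮 :=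
  resH1Hom_id_mem_restrictedSelmer H p 𝔮 e (fun σ x ↦ he σ x) (fun σ x ↦ he σ x) hc

end Eigen

/-! ## §2b. Additivity of `ψ ↦ ψ_*` and the splitting `H¹(H, E[p^∞]) = ι_* H¹(H, E[𝔮^∞]) ⊕ ι′_* H¹(H, E[𝔮̄^∞])` -/

section Splitting

variable {G : Type u} [Group G] [TopologicalSpace G] [IsTopologicalGroup G]
  {M : Type u} [AddCommGroup M] [DistribMulAction G M] [TopologicalSpace M] [DiscreteTopology M]
  {N : Type u} [AddCommGroup N] [DistribMulAction G N] [TopologicalSpace N] [DiscreteTopology N]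

/-- **Additivity of `H¹` in the coefficient map**: `(ψ₁ + ψ₂)_* = ψ₁_* + ψ₂_*` (on cocycles `h ↦ ψ(f h)` is additive in `ψ`).
[cite: SerreGaloisCohomology1997, I.§2.4] -/
theorem resH1Hom_add_coeff (ψ₁ ψ₂ : M →+ N) (h₁ : ∀ (x : G) (m : M), ψ₁ (ContinuousMonoidHom.id G x • m) = x • ψ₁ m)
    (h₂ : ∀ (x : G) (m : M), ψ₂ (ContinuousMonoidHom.id G x • m) = x • ψ₂ m)
    (h : ∀ (x : G) (m : M), (ψ₁ + ψ₂) (ContinuousMonoidHom.id G x • m) = x • (ψ₁ + ψ₂) m) :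
    resH1Hom (ContinuousMonoidHom.id G) (ψ₁ + ψ₂) h =
      resH1Hom (ContinuousMonoidHom.id G) ψ₁ h₁ + resH1Hom (ContinuousMonoidHom.id G) ψ₂ h₂ := by
  ext c
  obtain ⟨f, rfl⟩ := oneCocycleClass_surjective _ c
  rw [AddMonoidHom.add_apply, resH1Hom_oneCocycleClass, resH1Hom_oneCocycleClass, resH1Hom_oneCocycleClass,
    ← oneCocycleClass_add]
  congr 1

end Splitting

section EigenSplitting

variable {K : Type u} [Field K] (V : WeierstrassCurve K) (p : ℕ) [Fact p.Prime] (π : V.endRing) (r r' : ℤ_[p])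
  (H : Subgroup (absoluteGaloisGroup K))

/-- **The splitting of `H¹(H, E[p^∞])` along the two eigen-summands**: for complementary equivariant projectors `e`, `e′`
(`ι (e x) + ι′ (e′ x) = x`), every class satisfies `ι_* e_* c + ι′_* e′_* c = c`.
[cite: SerreGaloisCohomology1997, I.§2.4] [cite: Rubin1999, §2] -/
theorem resH1Hom_subtype_proj_add_eq
    (e : V.geomPrimaryTorsion p →+ ↥(V.endEigenPrimaryTorsion p π r))
    (e' : V.geomPrimaryTorsion p →+ ↥(V.endEigenPrimaryTorsion p π r'))
    (he : ∀ (σ : absoluteGaloisGroup K) (x : V.geomPrimaryTorsion p), e (σ • x) = σ • e x)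
    (he' : ∀ (σ : absoluteGaloisGroup K) (x : V.geomPrimaryTorsion p), e' (σ • x) = σ • e' x)
    (hsum : ∀ x, (e x : V.geomPrimaryTorsion p) + (e' x : V.geomPrimaryTorsion p) = x)
    (c : subgroupH1 H (V.geomPrimaryTorsion p)) :
    resH1Hom (ContinuousMonoidHom.id H) (V.endEigenPrimaryTorsion p π r).subtype (fun _ _ ↦ rfl)
        (resH1Hom (ContinuousMonoidHom.id H) e (fun σ x ↦ he σ x) c) +
      resH1Hom (ContinuousMonoidHom.id H) (V.endEigenPrimaryTorsion p π r').subtype (fun _ _ ↦ rfl)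
        (resH1Hom (ContinuousMonoidHom.id H) e' (fun σ x ↦ he' σ x) c) = c := by
  have h1 := congrArg (fun f ↦ f c) (resH1Hom_comp (ContinuousMonoidHom.id H) e (fun σ x ↦ he σ x)
    (ContinuousMonoidHom.id H) (V.endEigenPrimaryTorsion p π r).subtype (fun _ _ ↦ rfl))
  have h2 := congrArg (fun f ↦ f c) (resH1Hom_comp (ContinuousMonoidHom.id H) e' (fun σ x ↦ he' σ x)
    (ContinuousMonoidHom.id H) (V.endEigenPrimaryTorsion p π r').subtype (fun _ _ ↦ rfl))
  simp only [AddMonoidHom.comp_apply] at h1 h2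
  rw [h1, h2]
  have hψ₁ : ∀ (σ : H) (x : V.geomPrimaryTorsion p),
      ((V.endEigenPrimaryTorsion p π r).subtype.comp e) (ContinuousMonoidHom.id H σ • x) =
        σ • ((V.endEigenPrimaryTorsion p π r).subtype.comp e) x := fun σ x ↦ by
    simp only [AddMonoidHom.comp_apply, AddSubgroup.coe_subtype, Subgroup.smul_def, he,
      WeierstrassCurve.endEigenPrimaryTorsion.coe_smul]
    rfl
  have hψ₂ : ∀ (σ : H) (x : V.geomPrimaryTorsion p),
      ((V.endEigenPrimaryTorsion p π r').subtype.comp e') (ContinuousMonoidHom.id H σ • x) =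
        σ • ((V.endEigenPrimaryTorsion p π r').subtype.comp e') x := fun σ x ↦ by
    simp only [AddMonoidHom.comp_apply, AddSubgroup.coe_subtype, Subgroup.smul_def, he',
      WeierstrassCurve.endEigenPrimaryTorsion.coe_smul]
    rfl
  have hadd : (V.endEigenPrimaryTorsion p π r).subtype.comp e + (V.endEigenPrimaryTorsion p π r').subtype.comp e' =
      AddMonoidHom.id _ := AddMonoidHom.ext fun x ↦ hsum x
  have hsum' : ∀ (σ : H) (x : V.geomPrimaryTorsion p),
      ((V.endEigenPrimaryTorsion p π r).subtype.comp e + (V.endEigenPrimaryTorsion p π r').subtype.comp e')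
          (ContinuousMonoidHom.id H σ • x) =
        σ • ((V.endEigenPrimaryTorsion p π r).subtype.comp e + (V.endEigenPrimaryTorsion p π r').subtype.comp e') x :=
    fun σ x ↦ by rw [hadd]; rfl
  have hid := resH1Hom_add_coeff (G := H) ((V.endEigenPrimaryTorsion p π r).subtype.comp e)
    ((V.endEigenPrimaryTorsion p π r').subtype.comp e') hψ₁ hψ₂ hsum'
  have hφ : (ContinuousMonoidHom.id H).comp (ContinuousMonoidHom.id H) = ContinuousMonoidHom.id H :=
    ContinuousMonoidHom.ext fun _ ↦ rfl
  rw [resH1Hom_congr hφ rfl _ hψ₁, resH1Hom_congr hφ rfl _ hψ₂, ← AddMonoidHom.add_apply, ← hid,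
    resH1Hom_congr rfl hadd hsum' (fun _ _ ↦ rfl), resH1Hom_id, AddMonoidHom.id_apply]

end EigenSplitting

/-! ## §3. Road α by name: `W.j = −3375`, `L ∋ √−7`, `π² = π − 2`, `r² = r − 2`, `r′ = 1 − r` -/

section RoadAlpha

/-- **The eigen-projector `E[2^∞] → W* = E[𝔮_r^∞]` of road α**, for every member over every number field `L ∋ √−7`, every
`K`-rational `π` with `π² = π − 2` and every `2`-adic root `r`: `Γ_L`-equivariant, identity on `W*`, zero on the conjugate summand
`E[𝔮_{1−r}^∞]`, which is complementary by -w2 g7 `CMPrimes.endEigenPrimaryTorsion_two_structure`.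
[cite: Rubin1999, §2 and Prop. 5.4] [cite: Agboola2007, §3] -/
theorem exists_eigenProjector_two (W : WeierstrassCurve ℚ) [W.IsElliptic] (hj : W.j = -3375)
    (L : Type) [Field L] [NumberField L] {θ : L} (hθ : θ ^ 2 = -7) (π : (W.baseChange L).endRing)
    (hrel : (π : AddMonoid.End (W.baseChange L).geomPoints) * π = π - 2) {r : ℤ_[2]} (hr : r * r = r - 2) :
    ∃ e : (W.baseChange L).geomPrimaryTorsion 2 →+ ↥((W.baseChange L).endEigenPrimaryTorsion 2 π r),
      (∀ x : ↥((W.baseChange L).endEigenPrimaryTorsion 2 π r), e x = x) ∧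
      (∀ x ∈ (W.baseChange L).endEigenPrimaryTorsion 2 π (1 - r), e x = 0) ∧
      (∀ x, x - (e x : (W.baseChange L).geomPrimaryTorsion 2) ∈ (W.baseChange L).endEigenPrimaryTorsion 2 π (1 - r)) ∧
      ∀ (σ : absoluteGaloisGroup L) (x : (W.baseChange L).geomPrimaryTorsion 2), e (σ • x) = σ • e x := by
  obtain ⟨hinf, hsup, -⟩ := CMPrimes.endEigenPrimaryTorsion_two_structure W hj L hθ π hrel hr
  exact exists_eigenProjector (W.baseChange L) 2 π r (1 - r) hinf hsup

end RoadAlpha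

end Summit.BirchSwinnertonDyer.BirchSwinnertonDyer.Theorems.PrintCf2.RestrictedSelmerPair

end
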